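import Literature.Probability.Percolation.ArmSeparationExtGuard
import Literature.Probability.Percolation.TriLowestCrossingPairs
import HarnessLib

/-!
# Corner guards keep the tips of ALL terms of both explorations in the middle of the side

Topic `Literature/Probability/Percolation`; family `crit-perc` / near-critical percolation on `𝕋`.
A brick of the near-critical arm-separation theorem for four arms in the ADJACENT colour
arrangement (P. Nolin, EJP 13 (2008), Thm. 11, `j = 4`, `σ = BBWW` [arXiv 0711.4948: Thm. 10];
the last missing input `hsepAdj` of `Werner2009_lemma63_of_altSeparation_of_adjSeparation`).

`ext_tip_bounds_of_guards` (`ArmSeparationExtGuard.lean`) keeps the tip of an ARM in the middle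
`[-2M + R₁, -R₂]` of side `0` when the closed sites contain frames (guards) at scales `R₁, R₂`
about the two ends of the side; it is stated for paths starting at a site of norm `≤ M`. The pair
steps for two arms of the same colour (`TrapPair*.lean`) need middle tips for every TERM of the
explorations from below and from above — open crossings of the trapezoid starting on the inner
side `trapI M = {v₀ = M + 1}`. The same argument applies to any open path starting at a site `a`
with `a₀ ≤ 2M - 2 max(R₁, R₂)`:

* `tip_bounds_of_guards'` — the general statement;
* `term_tip_bounds_of_guards` — for a term of `(trapDomain M).lowestSeq`;
* `termUp_tip_bounds_of_guards` — for a term of `(trapDomain M).flip.lowestSeq`.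

Everything here is proved; no named facts are introduced.

## References

* P. Nolin, Near-critical percolation in two dimensions, *Electron. J. Probab.* 13 (2008), §4.4
  (arXiv 0711.4948: proof of Thm. 10) [Nolin2008].
-/

noncomputable section

open Set

namespace Literature.Probability.Percolation

open LatticeModels

/-- **Guards keep tips in the middle, for paths starting left of the guards.** If the closed sites
of `χ` contain frames at scales `R₁, R₂ ≥ 1` about `(2M, -2M)` and `(2M, 0)`, then the end
`z ∈ trapO M` of a `χ`-open path from a site `a` with `a₀ ≤ 2M - 2R₁` and `a₀ ≤ 2M - 2R₂` has
`-2M + R₁ ≤ z₁ ≤ -R₂`. [cite: Nolin2008, §4.4 Thm. 11 (proof) (arXiv 0711.4948: Thm. 10)] -/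
theorem tip_bounds_of_guards' {M R₁ R₂ : ℕ} (h₁ : 1 ≤ R₁) (h₂ : 1 ≤ R₂)
    {χ : SiteConfig (Site 2)} (hdn : χᶜ ∈ triFrameAt (extC₁ M) R₁) (hup : χᶜ ∈ triFrameAt (extC₂ M) R₂)
    {A : Set (Site 2)} {a z : Site 2} (ha₁ : a 0 ≤ 2 * (M : ℤ) - 2 * R₁) (ha₂ : a 0 ≤ 2 * (M : ℤ) - 2 * R₂) (hz : z ∈ trapO M)
    (hp : PathIn triGraph (A ∩ χ) a z) : -(2 * (M : ℤ)) + R₁ ≤ z 1 ∧ z 1 ≤ -(R₂ : ℤ) := by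
  obtain ⟨hz0, hz1, hz1'⟩ := trapO_coord hz
  constructor
  · by_contra hlt
    rw [not_le] at hlt
    obtain ⟨F⟩ := nonempty_frameData hdn
    obtain ⟨v, hvA, hvK⟩ := F.exists_mem_K h₁ (s := z) (t := a)
      (by simp only [extC₁, Matrix.cons_val_zero, Matrix.cons_val_one, Matrix.cons_val_fin_one]; omega)
      (by simp only [extC₁, Matrix.cons_val_zero, Matrix.cons_val_one, Matrix.cons_val_fin_one]; omega) hp.symm
    exact F.K_subset hvK hvA.2
  · by_contra hlt
    rw [not_le] at hlt
    obtain ⟨F⟩ := nonempty_frameData hup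
    obtain ⟨v, hvA, hvK⟩ := F.exists_mem_K h₂ (s := z) (t := a)
      (by simp only [extC₂, Matrix.cons_val_zero, Matrix.cons_val_one, Matrix.cons_val_fin_one]; omega)
      (by simp only [extC₂, Matrix.cons_val_zero, Matrix.cons_val_one, Matrix.cons_val_fin_one]; omega) hp.symm
    exact F.K_subset hvK hvA.2

/-- **Terms from below have middle tips under the guards** (`2Rᵢ + 1 ≤ M`). [cite: Nolin2008, §4.4 Thm. 11 (proof) (arXiv 0711.4948: Thm. 10)] -/
theorem term_tip_bounds_of_guards {M R₁ R₂ : ℕ} (h₁ : 1 ≤ R₁) (h₁M : 2 * R₁ + 1 ≤ M) (h₂ : 1 ≤ R₂) (h₂M : 2 * R₂ + 1 ≤ M)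
    {χ : SiteConfig (Site 2)} (hdn : χᶜ ∈ triFrameAt (extC₁ M) R₁) (hup : χᶜ ∈ triFrameAt (extC₂ M) R₂)
    {u : ℕ} {c : Finset (Site 2)} {z : Site 2} (hu : (trapDomain M).lowestSeq χ u = some (c, z)) :
    -(2 * (M : ℤ)) + R₁ ≤ z 1 ∧ z 1 ≤ -(R₂ : ℤ) := by
  obtain ⟨hc, hcω⟩ := JDomain.isCrossing_of_lowestSeq hu
  obtain ⟨f, hfc, hfI⟩ := hc.exists_start
  have hf0 := (mem_trapI.1 hfI).2
  refine tip_bounds_of_guards' h₁ h₂ hdn hup (A := (↑c : Set (Site 2))) (a := f) (by omega) (by omega) hc.tip_mem_J ?_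
  exact (hc.conn f hfc z hc.tip_mem).mono fun v hv => ⟨hv, hcω hv⟩

/-- **Terms from above have middle tips under the guards** (`2Rᵢ + 1 ≤ M`). [cite: Nolin2008, §4.4 Thm. 11 (proof) (arXiv 0711.4948: Thm. 10)] -/
theorem termUp_tip_bounds_of_guards {M R₁ R₂ : ℕ} (h₁ : 1 ≤ R₁) (h₁M : 2 * R₁ + 1 ≤ M) (h₂ : 1 ≤ R₂) (h₂M : 2 * R₂ + 1 ≤ M)
    {χ : SiteConfig (Site 2)} (hdn : χᶜ ∈ triFrameAt (extC₁ M) R₁) (hup : χᶜ ∈ triFrameAt (extC₂ M) R₂)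
    {u : ℕ} {d : Finset (Site 2)} {z : Site 2} (hu : (trapDomain M).flip.lowestSeq χ u = some (d, z)) :
    -(2 * (M : ℤ)) + R₁ ≤ z 1 ∧ z 1 ≤ -(R₂ : ℤ) := by
  obtain ⟨hd', hdω⟩ := JDomain.isCrossing_of_lowestSeq hu
  have hd := (JDomain.flip_isCrossing_iff _).1 hd'
  obtain ⟨f, hfd, hfI⟩ := hd.exists_start
  have hf0 := (mem_trapI.1 hfI).2
  refine tip_bounds_of_guards' h₁ h₂ hdn hup (A := (↑d : Set (Site 2))) (a := f) (by omega) (by omega) hd.tip_mem_J ?_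
  exact (hd.conn f hfd z hd.tip_mem).mono fun v hv => ⟨hv, hdω hv⟩

end Literature.Probability.Percolation
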